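import Mathlib
import HarnessLib
import Literature.MathematicalPhysics.QuantumLattice.GaugeGroups
import Literature.MathematicalPhysics.QuantumFieldTheory.ConstructiveQFTWave0
import Literature.MathematicalPhysics.QuantumFieldTheory.LatticeGaugeProofs
import Literature.MathematicalPhysics.QuantumFieldTheory.U1GinibreComparison
import Literature.MathematicalPhysics.QuantumLattice.AbelianFieldTensor
import Literature.MathematicalPhysics.QuantumLattice.AbelianMagneticFlux
import Summits.Ventures.LatticeQCDFlow.Exactness.SymmetricMetropolis
import Summits.Ventures.LatticeQCDFlow.Exactness.CompactHaar
import Summits.Ventures.LatticeQCDFlow.Scaling.LatticePeeling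
import Summits.Ventures.LatticeQCDFlow.Scaling.SliceTwistWitness
import Summits.Ventures.LatticeQCDFlow.Scaling.FluxTunnellingU1Explicit
import Summits.Ventures.LatticeQCDFlow.Scaling.BoxSpreadWitness
import Summits.Ventures.LatticeQCDFlow.Scaling.BoxTouch
import Summits.Ventures.LatticeQCDFlow.Scaling.FluxInsertionKernel
import Summits.Ventures.LatticeQCDFlow.Scaling.FluxInsertionLine
import Summits.Ventures.LatticeQCDFlow.Scaling.FluxInsertionBox
import Summits.Ventures.LatticeQCDFlow.Scaling.ConvolutionPowerCompensation
import Summits.Ventures.LatticeQCDFlow.Scaling.WilsonPatchLowerBound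
import Summits.Ventures.LatticeQCDFlow.Scaling.TiltedPatchEstimate

/-!
# The SHARP tunnelling floor of the flux-insertion Metropolis kernels: the necessity exponent `βN(1 − cos(π/N))` is attained

HONEST FRAMING: exact (Metropolis-corrected) sampling algorithms for lattice gauge theory;
figures of merit are autocorrelation/cost numbers at stated couplings and volumes; no
continuum-physics claim.

Venture `LatticeQCDFlow` (cell pub-lqcd), topic `Scaling`, FANOUT row 29 (theory2, gen-20), item 104a
(the instances — line and block — are item 104b `Scaling/FluxInsertionSharpFloorInstances`).
NEW WORK assembling items 98–100 (the insertion kernels, gen-19), 101 (compensation), 102 (Wilson patch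
lower bound) and 103 (tilted patch estimate) with lean-1's necessity theorem (item 97 (xi)); nothing
here is cited as a fact.  `U(1)`, `d = 2`, Wilson action, periodic `L × L` torus.

THE RESULT.  Gen-19 proved for the line-insertion kernel (`N = L`) and the block-insertion kernel
(`N = (l−1)(l+3)`) the FLOOR `P{Q ≠ Q'} ≥ ½e^{−βN(1−cos(2π/N))}(1 − …)`, and the action-currency
necessity law (lean-1's `u1_tunnelling_links`; item 97 `u1_tunnelling_sliceLinks_action`,
`u1_tunnelling_boxLinks_action`) is the CEILING `z₁(β)^{n+N}·P{Q ≠ Q'} ≤ 2e^{−βN(1−cos(π/N))}`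
(`N ≤ 2n`, `2n + 2 ≤ L²`; `z₁^{−(n+N)}` is polynomial in `β`): the floor RATE `N(1−cos(2π/N)) ≈ 2π²/N`
was FOUR times the necessity rate `N(1−cos(π/N)) ≈ π²/(2N)` (conjecture C9 of THEORY-2.md §4 asked
which is the truth).  THIS FILE closes the gap on the floor side, up to a factor tending to `1` with
the volume:

  **`u1_patchInsertion_sharp_floor`** (generic patch insertion `X ∈ {W, W⁻¹}` with plaquettes `e^{2iθ}`
  on `P`, `1` off `P`; `N = #P`, `N + 3 ≤ L²`, `0 ≤ θ ≤ π/3`, `κ = β cos θ ≥ 1`, free `λ, η ≥ 0`):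
  `(μ_{β,L} ⊗ K){Q ≠ Q'} ≥ ¼ · ρ_L · e^{−Nβ(1−cos θ) − β sin θ·η} ·
        (1 − 2e^{−λη + Nλ²/(2κ)} − Nπe^{1/2}√κ·e^{−κ(1+cos 3θ)})`,
  `ρ_L = e^{−β(L²−N)(1−cos(π/(L²−N−1)))} → 1` (`L → ∞`): the finite-volume price of closing the
  torus (item 101), the ONLY place the volume enters;
  instances (item 104b `Scaling/FluxInsertionSharpFloorInstances`): `u1_lineInsertion_sharp_floor`
  (`θ = π/L`, `N = L`), `u1_boxInsertion_sharp_floor` (`θ = α_l/2 = π/((l−1)(l+3))`,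
  `N = (l−1)(l+3) = (l+1)²−4`), and their real-number forms.
  With `η = √(N/κ)·t`, `λ = ηκ/N`: the correction `β sin θ·η ≤ βθ√(N/κ)t = O(t√(β/N))` for `θ = π/N`
  is SUB-LEADING, so `limsup_{β→∞} −(1/β) log P{Q ≠ Q'} ≤ N(1 − cos(π/N)) + (L²−N)(1 − cos(π/(L²−N−1)))`
  at fixed `L`, and `lim_{L→∞} lim_{β→∞} −(1/β) log P{Q ≠ Q'} = N(1 − cos(π/N))` together with the
  ceiling — the action-currency necessity rate IS the cost rate of these exact local kernels
  (conjecture C9 in the iterated limit; at fixed `L` the extra term is believed genuine — the torus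
  closing constraint forces the `L² − N` untouched plaquettes to carry the flux `π` at the half-way
  point — see THEORY-2.md v3.9 §4, C9′/C9″).

THE MECHANISM (why gen-19 lost the factor 4 and how it is recovered).  Gen-19 inserted the twist at
configurations on the principal branch and paid the FULL action of the twist, `S(W) = N(1−cos 2θ)`,
through the Metropolis acceptance.  Here the acceptance is made `= 1`: we insert only at configurations
`U` whose patch plaquettes `g_x`, written in half-angle variables `y_x = e^{iθ}g_x`, satisfy
`Σ_x Im y_x ≤ 0` — then `S(XU) − S(U) = 2 sin θ·Σ_x Im y_x ≤ 0` (`wilsonAction_insert_sub`) and the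
move is accepted surely (`compProd_insertionMH_ge_of_dir`).  The price moves from the acceptance to the
PROBABILITY of such `U`, which item 103 computes by tilting: `∏ w_β(g_x) = e^{−Nβ(1−cos θ)}·∏ w_κ(y_x)
e^{β sin θ Im y_x}`, i.e. exactly the half-way saddle `e^{−Nβ(1−cos θ)}` times a CENTRAL event of the
`κ`-weighted product law; item 102 transports the product-law bound to the Wilson measure on the torus
at the price `ρ_L`; the branch condition `|arg g_x| < π − 2θ` needed by gen-19's charge bookkeeping
(`bothChange_of_branch`, `bothChange_of_boxBranch`) follows from `Re y_x > −cos 3θ`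
(`arg_window_of_re_rot_gt`).
-/

noncomputable section

namespace Summit.Ventures.LatticeQCDFlow.Theory2.Lattice.Flux

open MeasureTheory ProbabilityTheory Real
open scoped ENNReal
open Literature.MathematicalPhysics.QuantumFieldTheory Literature.MathematicalPhysics.QuantumLattice
open Summit.Ventures.LatticeQCDFlow.Exactness
open Summit.Ventures.LatticeQCDFlow.Theory2.HaarConv

/-! ## §1 The kernel floor with sure acceptance -/

section Kernel

variable {d L : ℕ} [NeZero L]

/-- **SURE-ACCEPTANCE FLOOR.**  For the two-sided insertion kernel of `W` under `e^{−βS}` (`β ≥ 0`),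
one direction `X ∈ {W, W⁻¹}` and ANY measure `μ`:
`(μ ⊗ K){Q ≠ Q'} ≥ ½ μ{U : Q(XU) ≠ Q(U), S(XU) ≤ S(U)}` — on that event the proposal `XU` is drawn
with probability `½` and accepted with probability `1`. [folklore] -/
theorem compProd_insertionMH_ge_of_dir {β : ℝ} (hβ : 0 ≤ β) (W X : GaugeConfig d L Circle)
    (hX : X = W ∨ X = W⁻¹) (x₀ : Site d L) (μ' ν' : Fin d) (μ : Measure (GaugeConfig d L Circle))
    [SFinite μ] :
    2⁻¹ * μ {U | topCharge x₀ μ' ν' (X * U) ≠ topCharge x₀ μ' ν' U ∧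
        wilsonAction u1Rep (X * U) ≤ wilsonAction u1Rep U} ≤
      (μ ⊗ₘ insertionMH W (u1Weight (d := d) (L := L) β))
        {q | topCharge x₀ μ' ν' q.1 ≠ topCharge x₀ μ' ν' q.2} := by
  haveI : Fact (Measurable (u1Weight (d := d) (L := L) β)) := ⟨measurable_u1Weight β⟩
  have hm := measurable_topCharge (L := L) x₀ μ' ν'
  have hS := measurable_wilsonAction u1Rep continuous_u1Rep (d := d) (L := L)
  have hE : MeasurableSet {q : GaugeConfig d L Circle × GaugeConfig d L Circle |
      topCharge x₀ μ' ν' q.1 ≠ topCharge x₀ μ' ν' q.2} :=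
    (measurableSet_eq_fun (hm.comp measurable_fst) (hm.comp measurable_snd)).compl
  set A := {U : GaugeConfig d L Circle | topCharge x₀ μ' ν' (X * U) ≠ topCharge x₀ μ' ν' U ∧
      wilsonAction u1Rep (X * U) ≤ wilsonAction u1Rep U} with hA
  have hAm : MeasurableSet A :=
    ((measurableSet_eq_fun (hm.comp (measurable_const_mul X)) hm).compl).inter
      (measurableSet_le (hS.comp (measurable_const_mul X)) hS)
  rw [Measure.compProd_apply hE, ← lintegral_indicator_const hAm]
  refine lintegral_mono fun U => ?_
  by_cases hU : U ∈ A
  · rw [Set.indicator_of_mem hU]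
    have hB : MeasurableSet {V : GaugeConfig d L Circle | topCharge x₀ μ' ν' U ≠ topCharge x₀ μ' ν' V} :=
      measurableSet_topCharge_ne x₀ μ' ν' U
    refine le_trans ?_ (insertionMH_ge W (measurable_u1Weight β) U hB)
    have hXB : X * U ∈ {V : GaugeConfig d L Circle | topCharge x₀ μ' ν' U ≠ topCharge x₀ μ' ν' V} :=
      fun h => hU.1 h.symm
    have hacc : imhAcceptE (u1Weight (d := d) (L := L) β) U (X * U) = 1 := by
      have h1 : u1Weight (d := d) (L := L) β = fun V => Real.exp (-β * wilsonAction u1Rep V) := rfl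
      rw [h1, imhAcceptE_exp, min_eq_left (Real.one_le_exp (by nlinarith [hU.2])), ENNReal.ofReal_one]
    have hsum : {V : GaugeConfig d L Circle | topCharge x₀ μ' ν' U ≠ topCharge x₀ μ' ν' V}.indicator
          (imhAcceptE (u1Weight (d := d) (L := L) β) U) (X * U) ≤
        {V : GaugeConfig d L Circle | topCharge x₀ μ' ν' U ≠ topCharge x₀ μ' ν' V}.indicator
            (imhAcceptE (u1Weight (d := d) (L := L) β) U) (W * U) +
          {V : GaugeConfig d L Circle | topCharge x₀ μ' ν' U ≠ topCharge x₀ μ' ν' V}.indicator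
            (imhAcceptE (u1Weight (d := d) (L := L) β) U) (W⁻¹ * U) := by
      rcases hX with h | h
      · rw [h]; exact le_self_add
      · rw [h]; exact le_add_self
    calc (2⁻¹ : ℝ≥0∞) = 2⁻¹ * {V : GaugeConfig d L Circle | topCharge x₀ μ' ν' U ≠ topCharge x₀ μ' ν' V}.indicator
          (imhAcceptE (u1Weight (d := d) (L := L) β) U) (X * U) := by
          rw [Set.indicator_of_mem hXB, hacc, mul_one]
      _ ≤ _ := mul_le_mul_right hsum _
  · rw [Set.indicator_of_notMem hU]; exact bot_le

end Kernel

/-! ## §2 Two-dimensional `U(1)`: the action change of a patch insertion, the branch window -/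

section TwoDim

variable {L : ℕ} [NeZero L]

/-- **ACTION CHANGE OF A PATCH INSERTION** in half-angle variables: if `X` has plaquettes `e^{2iθ}` on
`P` and `1` off `P`, then `S(XU) − S(U) = 2 sin θ · Σ_{x∈P} Im(e^{iθ}U_x)`. [folklore] -/
theorem wilsonAction_insert_sub (θ : ℝ) (X U : GaugeConfig 2 L Circle) (P : Finset (Site 2 L))
    (hXP : ∀ x ∈ P, plaquetteHolonomy X x 0 1 = Circle.exp θ * Circle.exp θ)
    (hXn : ∀ x ∉ P, plaquetteHolonomy X x 0 1 = 1) :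
    wilsonAction u1Rep (X * U) - wilsonAction u1Rep U =
      2 * Real.sin θ * sumIm P (fun x => Circle.exp θ * plaquetteHolonomy U x 0 1) := by
  rw [wilsonAction_u1_eq, wilsonAction_u1_eq, ← Finset.sum_sub_distrib]
  have h1 : ∀ q : Plaquette 2 L,
      (1 - ((plaquetteHolonomy (X * U) q.1 q.2.1.1 q.2.1.2 : Circle) : ℂ).re) -
        (1 - ((plaquetteHolonomy U q.1 q.2.1.1 q.2.1.2 : Circle) : ℂ).re) =
      (fun x : Site 2 L => ((plaquetteHolonomy U x 0 1 : Circle) : ℂ).re -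
        ((plaquetteHolonomy X x 0 1 * plaquetteHolonomy U x 0 1 : Circle) : ℂ).re) (plaquetteEquivSite q) := by
    intro q
    obtain ⟨hq0, hq1⟩ := plaquette_dirs_eq q
    rw [hq0, hq1, plaquetteHolonomy_mul']
    show _ = ((plaquetteHolonomy U q.1 0 1 : Circle) : ℂ).re -
      ((plaquetteHolonomy X q.1 0 1 * plaquetteHolonomy U q.1 0 1 : Circle) : ℂ).re
    ring
  simp_rw [h1]
  rw [Fintype.sum_equiv plaquetteEquivSite _ (fun x : Site 2 L => ((plaquetteHolonomy U x 0 1 : Circle) : ℂ).re -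
        ((plaquetteHolonomy X x 0 1 * plaquetteHolonomy U x 0 1 : Circle) : ℂ).re) (fun q => rfl),
    ← Finset.sum_subset (Finset.subset_univ P) (fun x _ hx => by simp only [hXn x hx, one_mul, sub_self])]
  unfold sumIm
  rw [Finset.mul_sum]
  refine Finset.sum_congr rfl fun x hx => ?_
  have h := re_rot_sub_re_rot θ (Circle.exp θ * plaquetteHolonomy U x 0 1)
  rw [inv_mul_cancel_left, ← mul_assoc] at h
  rw [hXP x hx]
  exact h

/-- **THE BRANCH WINDOW FROM THE HALF-ANGLE CONDITION**: for `0 ≤ θ`, `3θ ≤ π` and a unit complex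
number `g` with `Re(e^{iθ}g) > −cos 3θ`, `2θ − π < arg g < π − 4θ`. [folklore] -/
theorem arg_window_of_re_rot_gt {θ : ℝ} (hθ0 : 0 ≤ θ) (hθ3 : 3 * θ ≤ π) (g : Circle)
    (h : -Real.cos (3 * θ) < ((Circle.exp θ * g : Circle) : ℂ).re) :
    2 * θ - π < Complex.arg (g : ℂ) ∧ Complex.arg (g : ℂ) < π - 4 * θ := by
  set y : Circle := Circle.exp θ * g with hy
  set φ : ℝ := Complex.arg (y : ℂ) with hφ
  have hre : Real.cos φ = ((y : Circle) : ℂ).re := by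
    rw [hφ, Complex.cos_arg (Circle.coe_ne_zero y), Circle.norm_coe, div_one]
  have hφπ : |φ| ≤ π := Complex.abs_arg_le_pi _
  have habs : |φ| < π - 3 * θ := by
    by_contra hc
    push Not at hc
    have h1 : Real.cos |φ| ≤ Real.cos (π - 3 * θ) :=
      Real.cos_le_cos_of_nonneg_of_le_pi (by linarith) hφπ hc
    rw [Real.cos_abs, Real.cos_pi_sub, hre] at h1
    linarith
  obtain ⟨hlo, hhi⟩ := abs_lt.mp habs
  have hg : g = Circle.exp (φ - θ) := by
    calc g = (Circle.exp θ)⁻¹ * y := by rw [hy, inv_mul_cancel_left]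
      _ = Circle.exp (φ - θ) := by
          rw [← Circle.exp_arg y, ← hφ, ← Circle.exp_neg, ← Circle.exp_add]; congr 1; ring
  have harg : Complex.arg (g : ℂ) = φ - θ := by
    rw [hg]; exact Circle.arg_exp (by linarith) (by linarith)
  rw [harg]
  constructor <;> linarith

/-! ## §3 The generic sharp floor -/

/-- **THE SHARP FLOOR OF A PATCH INSERTION** (`U(1)`, `d = 2`, `2 ≤ L`; see the module docstring):
for `β ≥ 0`, `0 ≤ θ`, `3θ ≤ π`, `κ = β cos θ ≥ 1`, `λ ≥ 0`, any `η`, an insertion direction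
`X ∈ {W, W⁻¹}` with plaquettes `e^{2iθ}` on the patch `P` (`#P + 3 ≤ L²`) and `1` off it, whose
insertion changes the flux charge on the window `2θ − π < F_x ≤ π − 2θ (x ∈ P)`:
`¼·ρ_L·e^{−(#P(β − β cos θ) + β sin θ·η)}·(1 − 2e^{−λη + #Pλ²/(2κ)} − #P·πe^{1/2}√κ·e^{−κ(1 + cos 3θ)})
   ≤ (μ_{β,L} ⊗ K_W){Q ≠ Q'}`, `ρ_L = e^{−β(L²−#P)(1−cos(π/(L²−#P−1)))}`. [folklore] -/
theorem u1_patchInsertion_sharp_floor (hL : 2 ≤ L) {β θ l η : ℝ} (hβ : 0 ≤ β) (hθ0 : 0 ≤ θ)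
    (hθ3 : 3 * θ ≤ π) (hκ : 1 ≤ β * Real.cos θ) (hl : 0 ≤ l)
    (W X : GaugeConfig 2 L Circle) (hX : X = W ∨ X = W⁻¹) (P : Finset (Site 2 L))
    (hP : P.card + 3 ≤ L ^ 2)
    (hXP : ∀ x ∈ P, plaquetteHolonomy X x 0 1 = Circle.exp θ * Circle.exp θ)
    (hXn : ∀ x ∉ P, plaquetteHolonomy X x 0 1 = 1)
    (hQ : ∀ U : GaugeConfig 2 L Circle,
      (∀ x ∈ P, 2 * θ - π < abelianFieldTensor U x 0 1 ∧ abelianFieldTensor U x 0 1 ≤ π - 2 * θ) →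
        topCharge (0 : Site 2 L) 0 1 (X * U) ≠ topCharge (0 : Site 2 L) 0 1 U) :
    ENNReal.ofReal (4⁻¹ *
        Real.exp (-(β * (((L ^ 2 - P.card : ℕ) : ℝ) *
          (1 - Real.cos (π / ((L ^ 2 - P.card - 1 : ℕ) : ℝ)))))) *
        Real.exp (-(P.card * (β - β * Real.cos θ) + β * Real.sin θ * η)) *
        (1 - 2 * Real.exp (-(l * η) + P.card * (l ^ 2 / (2 * (β * Real.cos θ)))) -
          P.card * (π * Real.exp (1 / 2) * Real.sqrt (β * Real.cos θ)) *
            Real.exp (-(β * Real.cos θ * (1 + Real.cos (3 * θ)))))) ≤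
      ((wilsonMeasure (d := 2) (L := L) u1Rep β) ⊗ₘ insertionMH W (u1Weight (d := 2) (L := L) β))
        {q | topCharge (0 : Site 2 L) 0 1 q.1 ≠ topCharge (0 : Site 2 L) 0 1 q.2} := by
  haveI : Fact (Measurable (u1Weight (d := 2) (L := L) β)) := ⟨measurable_u1Weight β⟩
  set μW := wilsonMeasure (d := 2) (L := L) u1Rep β with hμW
  haveI : IsProbabilityMeasure μW := isProbabilityMeasure_wilsonMeasure u1Rep continuous_u1Rep β
  have hsin : 0 ≤ Real.sin θ := Real.sin_nonneg_of_nonneg_of_le_pi hθ0 (by linarith [Real.pi_pos])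
  have hκβ : β * Real.cos θ ≤ β := mul_le_of_le_one_right hβ (Real.cos_le_one θ)
  set C : ℝ := Real.cos (3 * θ) with hC
  -- the events
  set A := {U : GaugeConfig 2 L Circle | topCharge (0 : Site 2 L) 0 1 (X * U) ≠ topCharge (0 : Site 2 L) 0 1 U ∧
      wilsonAction u1Rep (X * U) ≤ wilsonAction u1Rep U} with hA
  set B := {U : GaugeConfig 2 L Circle | (fun x => plaquetteHolonomy U x 0 1) ∈ goodG P θ η C} with hB
  have hBA : B ⊆ A := by
    intro U hU
    have hg : (fun x => plaquetteHolonomy U x 0 1) ∈ goodG P θ η C := hU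
    simp only [goodG, goodY, Set.mem_setOf_eq] at hg
    obtain ⟨hre, _, hsum⟩ := hg
    refine ⟨hQ U fun x hx => ?_, ?_⟩
    · have hw := arg_window_of_re_rot_gt hθ0 hθ3 (plaquetteHolonomy U x 0 1) (hre x hx)
      exact ⟨hw.1, (hw.2.trans_le (by linarith)).le⟩
    · have h := wilsonAction_insert_sub θ X U P hXP hXn
      nlinarith [hsin, hsum]
  -- the three inputs
  have hK := compProd_insertionMH_ge_of_dir hβ W X hX (0 : Site 2 L) 0 1 μW
  have hF2 := Lattice.TwoDim.u1_measure_patch_ge hL hβ P hP (measurableSet_goodG P θ η C)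
    (goodG_congr P θ η C)
  have hF3 := goodG_lower_bound P (η := η) (C := C) hβ hsin hκ hl
  have hz : z1 u1Rep β ^ P.card ≤ z1 u1Rep (β * Real.cos θ) ^ P.card :=
    pow_le_pow_left' (z1_u1_anti hκβ) _
  have hz0 : z1 u1Rep β ^ P.card ≠ 0 := pow_ne_zero _ (z1_u1_ne_zero β)
  have hzt : z1 u1Rep β ^ P.card ≠ ⊤ :=
    ENNReal.pow_ne_top (ne_top_of_le_ne_top ENNReal.one_ne_top (z1_u1_le_one hβ))
  have h22 : (2⁻¹ : ℝ≥0∞) * 2 = 1 := ENNReal.inv_mul_cancel two_ne_zero ENNReal.ofNat_ne_top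
  -- abbreviations
  set z := z1 u1Rep β ^ P.card with hzdef
  set zκ := z1 u1Rep (β * Real.cos θ) ^ P.card with hzκ
  set ρ := ENNReal.ofReal (Real.exp (-(β * (((L ^ 2 - P.card : ℕ) : ℝ) *
          (1 - Real.cos (π / ((L ^ 2 - P.card - 1 : ℕ) : ℝ))))))) with hρ
  set E := ENNReal.ofReal (Real.exp (-(P.card * (β - β * Real.cos θ) + β * Real.sin θ * η))) with hEdef
  set D := ENNReal.ofReal (1 - 2 * Real.exp (-(l * η) + P.card * (l ^ 2 / (2 * (β * Real.cos θ)))) -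
          P.card * (π * Real.exp (1 / 2) * Real.sqrt (β * Real.cos θ)) *
            Real.exp (-(β * Real.cos θ * (1 + Real.cos (3 * θ))))) with hDdef
  set I := ∫⁻ g, (goodG P θ η C).indicator 1 g * ∏ x ∈ P, u1W β (g x)
      ∂(Measure.pi fun _ : Site 2 L => haarProbability Circle) with hI
  set ν := (μW ⊗ₘ insertionMH W (u1Weight (d := 2) (L := L) β))
        {q | topCharge (0 : Site 2 L) 0 1 q.1 ≠ topCharge (0 : Site 2 L) 0 1 q.2} with hν
  -- rewrite the claimed floor as `2⁻¹ * 2⁻¹ * ρ * E * D`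
  have hlhs : ENNReal.ofReal (4⁻¹ *
        Real.exp (-(β * (((L ^ 2 - P.card : ℕ) : ℝ) *
          (1 - Real.cos (π / ((L ^ 2 - P.card - 1 : ℕ) : ℝ)))))) *
        Real.exp (-(P.card * (β - β * Real.cos θ) + β * Real.sin θ * η)) *
        (1 - 2 * Real.exp (-(l * η) + P.card * (l ^ 2 / (2 * (β * Real.cos θ)))) -
          P.card * (π * Real.exp (1 / 2) * Real.sqrt (β * Real.cos θ)) *
            Real.exp (-(β * Real.cos θ * (1 + Real.cos (3 * θ)))))) = 2⁻¹ * 2⁻¹ * ρ * E * D := by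
    rw [show (4⁻¹ : ℝ) = 2⁻¹ * 2⁻¹ by norm_num, ENNReal.ofReal_mul (by positivity),
      ENNReal.ofReal_mul (by positivity), ENNReal.ofReal_mul (by positivity),
      ENNReal.ofReal_mul (by positivity), ENNReal.ofReal_inv_of_pos two_pos, ENNReal.ofReal_ofNat]
  rw [hlhs]
  refine (ENNReal.mul_le_mul_iff_right hz0 hzt).mp ?_
  calc z * (2⁻¹ * 2⁻¹ * ρ * E * D) = 2⁻¹ * (2⁻¹ * (ρ * (E * (D * z)))) := by ring
    _ ≤ 2⁻¹ * (2⁻¹ * (ρ * (E * (D * zκ)))) :=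
        mul_le_mul_right (mul_le_mul_right (mul_le_mul_right (mul_le_mul_right
          (mul_le_mul_right hz _) _) _) _) _
    _ ≤ 2⁻¹ * (2⁻¹ * (ρ * (2 * I))) := mul_le_mul_right (mul_le_mul_right (mul_le_mul_right hF3 _) _) _
    _ = 2⁻¹ * ((2⁻¹ * 2) * (ρ * I)) := by ring
    _ = 2⁻¹ * (ρ * I) := by rw [h22, one_mul]
    _ ≤ 2⁻¹ * (z * μW B) := mul_le_mul_right hF2 _
    _ ≤ 2⁻¹ * (z * μW A) := mul_le_mul_right (mul_le_mul_right (measure_mono hBA) _) _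
    _ = z * (2⁻¹ * μW A) := by ring
    _ ≤ z * ν := mul_le_mul_right hK _

end TwoDim

end Summit.Ventures.LatticeQCDFlow.Theory2.Lattice.Flux

end
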